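/-
Origin: expansion seat `prover-pub-hodgecm-own-htheta-g2-0`, handover #H15 2026-08-21T06:32Z md5 6c94e7b92bbc (137 l.; NEW additive KERNEL leaf beside E, companion of #H14 for pub-hodgecm2 own-b01's face junction (lead 1-g87 routing STATUS l.15420); imports #H14 `HodgeCM.Model.LiuCMSideSubCorner` + LANDED `HodgeCM.Model.LiuDictionaryTower` + `HodgeCM.Model.HsmallOfCommonReflexUnion` — NO RUN-72 dependency; in-run ROWDEP #H14 ≺ #H15; ns HodgeCM.Model; 3 theorems, 0 defs, nothing cited: THE SINGLE-BLOCK ROW-9 TOWER SOCKETS WITH THE CM SIDE AT A SUB-CORNER AND NO SEXTIC SCOPE — `subset_span_of_block_of_below_of_isSubCorner` (#H14's dictionary theorem with `hIso` only below a conjugate of `K_f(3)`), `subset_span_of_tower_block_of_isSubCorner` (through `LiuDictionary.ofTower`, component families in `block μ`), `hsmall_of_tower_at_block_of_isSubCorner` (E's `hsmall` AT `(V, c, i)` from `h418 := Thm418C` + `hR` + `GoodCtx` + `hJ : ∃ μ, PhiMu μ ∧ (∀ d, adm μ d → d.IsSubCorner c.K (c.Ψ i) c.σ) ∧ families` — #H7's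 `hsmall_of_tower_at_block` with `hcorner` weakened to the sub-corner and NO `h6` ∕ `IsNormalClosure`); the remaining face-side inputs are the theta lane's families ∕ `PhiMu` at faces and binder-1-g20's «admissible record ⇒ sub-corner at the lift type without primitivity» (`Model/Binders/JLiuSubCornerOfReflex`, in progress); NAMES for audit: HodgeCM.Model.subset_span_of_block_of_below_of_isSubCorner · HodgeCM.Model.subset_span_of_tower_block_of_isSubCorner · HodgeCM.Model.hsmall_of_tower_at_block_of_isSubCorner) (`HOME/pub-hodgecm-own-htheta/stage73/HodgeCM/Model/HsmallOfBlockAtSubCorner.lean`, md5 6c94e7b92bbc, 137 lines);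
landed by the gen-31 packager (p-g31) in gate run 73 as `HodgeCM/Model/HsmallOfBlockAtSubCorner.lean` (verbatim).
-/
/-
Copyright (c) 2026 the pub-hodgecm formalisation cell (harness21).  New file, not vendored.
Origin: ROW-9 OWNER seat `prover-pub-hodgecm-own-htheta-g2-0` (unit pub-hodgecm-own-htheta, gen 2; named single owner of binder row 9 `hΘ` = the (J-Liu-Θ)
junction), 2026-08-21 — companion of #H14 `Model/LiuCMSideSubCorner` for pub-hodgecm2 own-b01's face junction (lead 1-g87 routing STATUS l.15420).
Target in PKG: `HodgeCM/Model/HsmallOfBlockAtSubCorner.lean` (NEW additive KERNEL leaf beside E; imports this seat's #H14 + the LANDED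
`Model/LiuDictionaryTower` (binder-1) and `Model/HsmallOfCommonReflexUnion` (binder-1); NO RUN-72 dependency; nothing imports it; ROWDEP #H14 ≺ this;
drop alone on bounce).  KERNEL ONLY: 3 theorems, 0 defs, nothing cited, no hypothesis kind of E.  Nothing here is a claim of the manuscripts under adjudication.

WHAT IT IS — THE SINGLE-BLOCK ROW-9 SOCKETS WITH THE CM SIDE AT A SUB-CORNER AND NO SEXTIC SCOPE.  This seat's #H7 `Model/HsmallOfBlockAt` derives E's
`hsmall` at `(V, c, i)` from ONE block and `Thm418C` alone, discharging the CM-side clause by the ISO corner `LiuCMSide.IsCorner`, which needs PerL's scope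
`finrank c.K = 6 ∧ IsNormalClosure ℚ c.K L` (primitivity ⇒ reflex field = `K`).  Here the same two tower-level sockets are re-run with the clause WEAKENED to
#H14's `LiuCMSide.IsSubCorner` and WITHOUT any scope hypothesis — the form a FACE of a Galois sextic can meet (corner type induced from the imaginary
quadratic subfield; pub-hodgecm2 p251194):
* `subset_span_of_block_of_below_of_isSubCorner` — #H14's dictionary-level theorem with `hIso` asked only below a conjugate of `K_f(3)`;
* `subset_span_of_tower_block_of_isSubCorner` — through the tower (`LiuDictionary.ofTower`, component families in `block μ`);
* `hsmall_of_tower_at_block_of_isSubCorner` — E's `hsmall` AT `(V, c, i)`: `∃ Γ₀ ∀ Γ ≤ Γ₀ ∃ M k σ', σ' ∘ k = c.σ ∧ R.Theta V c i Γ ⊆ Uiso Γ M (inflate k (c.Ψ i)) σ'`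
  from `h418 := Thm418C`, `hR`, `GoodCtx`, and `hJ : ∃ μ, PhiMu μ ∧ (∀ d, adm μ d → d.IsSubCorner c.K (c.Ψ i) c.σ) ∧ (component families in block μ)` —
  NO `h6`.  The remaining face-side inputs are the theta lane's (families ∕ `PhiMu` at faces) and binder-1-g20's «admissible record ⇒ sub-corner at the lift
  type without primitivity» (`Model/Binders/JLiuSubCornerOfReflex`, in progress).
0 `proof-hole`; expected `#print axioms` ⊆ {propext, Classical.choice, Quot.sound}.
-/
import Summits.HodgeConjecture.HodgeCM.Model.LiuCMSideSubCorner
import Summits.HodgeConjecture.HodgeCM.Model.LiuDictionaryTower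
import Summits.HodgeConjecture.HodgeCM.Model.HsmallOfCommonReflexUnion

set_option autoImplicit false

noncomputable section

open Literature.AlgebraicGeometry.Motives (CMType)
open Literature.AlgebraicGeometry.HodgeTheory
open Literature.NumberTheory.Automorphic.PicardCM
open Literature.NumberTheory.Transcendental (Arapura2012_Cor_15_4_6)

namespace HodgeCM.Model

open HodgeCM.Model.TowerLevel HodgeCM.Model.TowerCarrier HodgeCM.Literature.Theta HodgeCM.Literature.Theta.LiuAlbaneseModuleDatum
open HodgeCM.CMTypeOps (inflate inflate_id)
open HodgeCM.Universe (ThetaModel)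

/-! ## §1 Dictionary level, `hIso` only below a conjugate of `K_f(3)` -/

section Dictionary

variable {hHD : exists_isReal_hodgeModel} {hI : hodgePQ_independent_of_hodgeModel}
  {h₁ : BallQuotientUniformised} {h₃ : CMAbelianVarietyRealised}
variable {L : CMField} {ι₁ : L →+* ℂ} {V : HermSpace3 L ι₁} (T : LiuDictionary hHD hI h₁ h₃ V)

/-- #H14's `subset_span_of_block_of_isSubCorner` with `hIso` asked only at levels below a conjugate of `K_f(3)` (threshold cut down to `Level.three`).
[folklore] -/
theorem subset_span_of_block_of_below_of_isSubCorner (h418 : T.Thm418C)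
    {K : CMField} {Ψ : CMType K} {σ : K →+* ℂ} (μ : T.Char) (hΦ : T.PhiMu μ)
    (hsub : ∀ d : LiuCMSide, T.adm μ d → d.IsSubCorner K Ψ σ)
    (Θ : ∀ Γ : Level V, Set ((picardCMUniverse hHD hI h₁ h₃).CohC ((picardCMUniverse hHD hI h₁ h₃).pms L ι₁ V Γ) 1))
    (hIso : ∀ (Γ : Level V), Γ.BelowConjThree → ∀ ω ∈ Θ Γ, ∃ x : T.H,
      x ∈ fixedBy Γ.K T.H ∧ T.res Γ x = ω ∧ x ∈ T.block μ) :
    ∃ Γ₀ : Level V, ∀ Γ ≤ Γ₀,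
      Θ Γ ⊆ Submodule.span ℂ (⋃ D : CommonReflexInput K Ψ σ, D.surfaceClasses hHD hI h₁ h₃ V Γ) := by
  classical
  let Θ' : ∀ Γ : Level V, Set ((picardCMUniverse hHD hI h₁ h₃).CohC ((picardCMUniverse hHD hI h₁ h₃).pms L ι₁ V Γ) 1) :=
    fun Γ ↦ if Γ.BelowConjThree then Θ Γ else ∅
  have hIso' : ∀ (Γ : Level V), ∀ ω ∈ Θ' Γ, ∃ x : T.H, x ∈ fixedBy Γ.K T.H ∧ T.res Γ x = ω ∧ x ∈ T.block μ := by
    intro Γ ω hω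
    by_cases hΓ : Γ.BelowConjThree
    · have hω' : ω ∈ Θ Γ := by simpa only [Θ', if_pos hΓ] using hω
      exact hIso Γ hΓ ω hω'
    · simp only [Θ', if_neg hΓ, Set.mem_empty_iff_false] at hω
  obtain ⟨Γ₀, hΓ₀⟩ := subset_span_of_block_of_isSubCorner T h418 μ hΦ hsub Θ' hIso'
  refine ⟨Γ₀ ⊓ Level.three V, fun Γ hΓ ω hω ↦ ?_⟩
  have hb : Γ.BelowConjThree := Level.belowConjThree_of_le_three (hΓ.trans inf_le_right)
  have hω' : ω ∈ Θ' Γ := by simpa only [Θ', if_pos hb] using hω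
  exact hΓ₀ Γ (hΓ.trans inf_le_left) hω'

end Dictionary

/-! ## §2 Through the tower, and E's `hsmall` at a point — no sextic scope -/

section Tower

variable (hHD : exists_isReal_hodgeModel) (hI : hodgePQ_independent_of_hodgeModel)
  (h₁ : BallQuotientUniformised) (h₃ : CMAbelianVarietyRealised)
variable {L : CMField} {ι₁ : L →+* ℂ} (V : HermSpace3 L ι₁)

/-- **ROW 9 THROUGH THE TOWER, ONE BLOCK, SUB-CORNER CM SIDE** (#H7 `subset_span_of_tower_block` with `hcorner` weakened to `hsub`). [folklore] -/
theorem subset_span_of_tower_block_of_isSubCorner (hA : Arapura2012_Cor_15_4_6)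
    (Char : Type) (Adm : Char → Type) (Ω : (μ : Char) → Adm μ → Type)
    [∀ μ a, AddCommGroup (Ω μ a)] [∀ μ a, Module ℂ (Ω μ a)] [∀ μ a, Module (adelicAlgebra V) (Ω μ a)]
    [∀ μ a, IsScalarTower ℂ (adelicAlgebra V) (Ω μ a)] (PhiMu : Char → Prop) (adm : Char → LiuCMSide → Prop)
    (h418 : (LiuDictionary.ofTower hHD hI h₁ h₃ hA V Char Adm Ω PhiMu adm).Thm418C)
    {K : CMField} {Ψ : CMType K} {σ : K →+* ℂ}
    (μ : Char) (hΦ : PhiMu μ) (hsub : ∀ d : LiuCMSide, adm μ d → d.IsSubCorner K Ψ σ)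
    (Θ : ∀ Γ : Level V, Set ((picardCMUniverse hHD hI h₁ h₃).CohC ((picardCMUniverse hHD hI h₁ h₃).pms L ι₁ V Γ) 1))
    (hfam : ∀ (Γ : Level V) (hΓ : Γ.BelowConjThree), ∀ ω ∈ Θ Γ,
      ∃ c : towerLevel hHD hI (ballQuotientUniformisedDatum_of h₁) h₃ hA Γ hΓ,
        TowerLevel.res hHD hI (ballQuotientUniformisedDatum_of h₁) h₃ hA c = ω ∧
          (ofLevel hHD hI (ballQuotientUniformisedDatum_of h₁) h₃ hA Γ hΓ c :
              (LiuDictionary.ofTower hHD hI h₁ h₃ hA V Char Adm Ω PhiMu adm).H) ∈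
            (LiuDictionary.ofTower hHD hI h₁ h₃ hA V Char Adm Ω PhiMu adm).block μ) :
    ∃ Γ₀ : Level V, ∀ Γ ≤ Γ₀,
      Θ Γ ⊆ Submodule.span ℂ (⋃ D : CommonReflexInput K Ψ σ, D.surfaceClasses hHD hI h₁ h₃ V Γ) :=
  subset_span_of_block_of_below_of_isSubCorner (LiuDictionary.ofTower hHD hI h₁ h₃ hA V Char Adm Ω PhiMu adm) h418 μ hΦ hsub Θ
    fun Γ hΓ ω hω ↦ by
      obtain ⟨c, hc, hblock⟩ := hfam Γ hΓ ω hω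
      exact LiuDictionary.hIso_of_towerLevel hHD hI h₁ h₃ hA Char Adm Ω PhiMu adm hΓ c hc _ hblock

/-- **E's `hsmall` AT `(V, c, i)` FROM ONE BLOCK WITH THE CM SIDE AT A SUB-CORNER — no sextic scope** (#H7 `hsmall_of_tower_at_block` with the clause
`∀ d, adm μ d → d.IsSubCorner c.K (c.Ψ i) c.σ`; witnesses `M := c.K`, `k := id`, `σ' := c.σ`; Riemann's `hR` turns the span into `Uiso`). [folklore] -/
theorem hsmall_of_tower_at_block_of_isSubCorner (hR : DeligneMilne1982_Thm_6_20_full) (hA : Arapura2012_Cor_15_4_6)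
    (R : (picardCMUniverse hHD hI h₁ h₃).ThetaModel) (c : SeesawCtx L)
    (Char : Type) (Adm : Char → Type) (Ω : (μ : Char) → Adm μ → Type)
    [∀ μ a, AddCommGroup (Ω μ a)] [∀ μ a, Module ℂ (Ω μ a)] [∀ μ a, Module (adelicAlgebra V) (Ω μ a)]
    [∀ μ a, IsScalarTower ℂ (adelicAlgebra V) (Ω μ a)] (PhiMu : Char → Prop) (adm : Char → LiuCMSide → Prop)
    (h418 : (LiuDictionary.ofTower hHD hI h₁ h₃ hA V Char Adm Ω PhiMu adm).Thm418C)
    (hgood : R.GoodCtx ι₁ c) (i : Fin 4)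
    (hJ : ∃ μ : Char,
        PhiMu μ ∧ (∀ d : LiuCMSide, adm μ d → d.IsSubCorner c.K (c.Ψ i) c.σ) ∧
        ∀ (Γ : Level V) (hΓ : Γ.BelowConjThree), ∀ ω ∈ R.Theta V c i Γ,
          ∃ cf : towerLevel hHD hI (ballQuotientUniformisedDatum_of h₁) h₃ hA Γ hΓ,
            TowerLevel.res hHD hI (ballQuotientUniformisedDatum_of h₁) h₃ hA cf = ω ∧
              (ofLevel hHD hI (ballQuotientUniformisedDatum_of h₁) h₃ hA Γ hΓ cf :
                  (LiuDictionary.ofTower hHD hI h₁ h₃ hA V Char Adm Ω PhiMu adm).H) ∈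
                (LiuDictionary.ofTower hHD hI h₁ h₃ hA V Char Adm Ω PhiMu adm).block μ) :
    ∃ Γ₀ : Level V, ∀ Γ ≤ Γ₀,
      ∃ (M : CMField) (k : c.K →+* M) (σ' : M →+* ℂ), σ'.comp k = c.σ ∧
        R.Theta V c i Γ ⊆ (picardCMUniverse hHD hI h₁ h₃).Uiso Γ M (inflate k (c.Ψ i)) σ' := by
  obtain ⟨μ, hΦ, hsub, hfam⟩ := hJ
  obtain ⟨Γ₀, hΓ₀⟩ := subset_span_of_tower_block_of_isSubCorner hHD hI h₁ h₃ V hA Char Adm Ω PhiMu adm h418 μ hΦ hsub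
    (fun Γ ↦ R.Theta V c i Γ) hfam
  refine ⟨Γ₀, fun Γ hΓ ↦ ⟨c.K, RingHom.id _, c.σ, RingHom.comp_id _, ?_⟩⟩
  rw [inflate_id]
  exact fun x hx ↦ span_iUnion_surfaceClasses_le_Uiso hHD hI h₁ h₃ hR V Γ (hgood.mem i) (hΓ₀ Γ hΓ hx)

end Tower

end HodgeCM.Model

end
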